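import Summits.CriticalPhenomena.CardyFormulaZ2.Theorems.CardyWhiteToColouredSimilarityUpgradeStubDualSum
import Summits.CriticalPhenomena.CardyFormulaZ2.Theorems.CardyWhiteToColouredSimilarityUpgradeStubLimitDuality
import Summits.CriticalPhenomena.CardyFormulaZ2.Theorems.CardyWhiteToColouredSimilarityUpgradeStubLShapeHalf
import Summits.CriticalPhenomena.CardyFormulaZ2.Theorems.CardyWhiteToColouredSimilarityUpgradeStubHeartLShape
import Summits.CriticalPhenomena.CardyFormulaZ2.Theorems.CardyWhiteToColouredSimilarityUpgradeStubPolyominoHeartSuffices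
import Summits.CriticalPhenomena.CardyFormulaZ2.Theorems.CardyWhiteToColouredSimilarityUpgradeStubSymmetricHalfFull
import Summits.CriticalPhenomena.CardyFormulaZ2.Theorems.CardyWhiteToColouredSimilarityUpgradeStubHeartOfSymmetric
import Summits.CriticalPhenomena.CardyFormulaZ2.Theorems.CardyWhiteToColouredSimilarityUpgradeHeartIffCrux

/-!
# Crux `SimilarityUpgrade` (stmt-CriticalPhenomena-4597), line `registered`, lead c4: the cycle's bedrock, UNCONDITIONALLY

Route `CardyWhiteToColoured`, sub-problem `CardyFormulaZ2`.  The c4 sub-goals were registered and landed in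
dependency order with their upstream statements as explicit hypotheses (so that the stub-workers could run in
parallel).  With `stub_dualSum` (limit duality for EVERY conformal rectangle, p160431; also closing
`CardyOrderDuality.DualSum`, stmt-4716) now a tree theorem, this file discharges those hypotheses and records the
cycle's results in closed form (`stub_c4Bedrock`, one conjunction, each conjunct also as a named theorem):

1. `limitDuality` — full bond-`ℤ²` crossing limits of conjugate markings are complementary, for every `R` (G1);
2. `tendsto_half_lShapeQuad` — the diagonal-symmetric L-quad is crossed with probability `→ 1/2`;
3. `cardy_lShapeQuad` — hence satisfies CARDY'S FORMULA (its modulus is `1/2`): the first reflex-cornered instance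
   of the summit conjunct `CardyFormulaZ2` in the tree (the square: `cardy_unitSquareQuad`);
4. `rectilinearHeart_lShapeQuad` — the registered heart H3 (`stub_rectilinearHeart`) holds at `R = lShapeQuad`
   against EVERY corner box: the first non-similar instance of H3;
5. `rectilinearHeart_of_symmetric` — more generally H3 holds for every conformal rectangle carrying an affine
   lattice anti-symmetry `z ↦ u z̄ + v` (`u ∈ {±1, ±i}`) exchanging the two arc pairs;
6. `polyominoHeart_iff_similarityUpgrade` — the crux is EQUIVALENT to H3 restricted to POLYOMINO quads with lattice
   marks (a countable family of identities "Φ(lattice polygon) = Φ(box of equal modulus)"; `→` is c3's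
   `modulus_determines_of_similarityUpgrade`, `←` is `stub_polyominoHeartSuffices` through the proved
   `CardyTensorRG.PolyominoToJordan`).

References: O. Schramm, S. Smirnov, Ann. Probab. 39 (2011) §1.3, Lemma 5.1; J. Cardy, J. Phys. A 25 (1992) L201;
B. Bollobás, O. Riordan, *Percolation* (2006) Ch. 7 §7.1.
-/

noncomputable section

namespace Summit.CriticalPhenomena.CardyFormulaZ2.Cruxes.SimilarityUpgrade.Stubs

open Filter Topology Set MeasureTheory
open Literature.Probability.RandomPlanarGeometry
open Literature.Probability.Percolation
open Summit.CriticalPhenomena.CardyFormulaZ2.Theorems.RectilinearCardy.Negative (lShapeQuad)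

/-- **G1, unconditionally: full limits of conjugate markings are complementary**, for every conformal rectangle
(`stub_limitDuality` fed with the tree theorem `stub_dualSum`). [cite: SchrammSmirnov2011, Lemma 5.1] -/
theorem limitDuality (Φ : ConformalRectangle → ℝ)
    (hlim : ∀ R : ConformalRectangle, Tendsto (bondDomainCrossingProb R) (𝓝[>] (0 : ℝ)) (𝓝 (Φ R)))
    (R R' : ConformalRectangle) (hc : R'.carrier = R.carrier)
    (harcs : R'.arc 0 = R.arc 1 ∧ R'.arc 2 = R.arc 3 ∨ R'.arc 0 = R.arc 3 ∧ R'.arc 2 = R.arc 1) :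
    Φ R + Φ R' = 1 :=
  stub_limitDuality stub_dualSum Φ hlim R R' hc harcs

/-- **The diagonal-symmetric L-quad is crossed with probability `→ 1/2`**, unconditionally. [cite: CardyJPhysA1992] -/
theorem tendsto_half_lShapeQuad :
    Tendsto (bondDomainCrossingProb lShapeQuad) (𝓝[>] (0 : ℝ)) (𝓝 (1 / 2)) :=
  stub_lShapeHalf stub_dualSum

/-- **Cardy's formula holds for the L-quad** `((0,2)² ∖ [1,2]²; 0, 2, 1+i, 2i)`, unconditionally: the first
reflex-cornered instance of the summit conjunct `CardyFormulaZ2`. [cite: CardyJPhysA1992] -/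
theorem cardy_lShapeQuad : lShapeQuad.HasCrossingLimit (bondDomainCrossingProb lShapeQuad) Literature.Probability.RandomPlanarGeometry.cardyFunction :=
  cardy_lShapeQuad_of_dualSum stub_dualSum

/-- **The heart H3 at `R = lShapeQuad`, unconditionally**: every full bond-`ℤ²` crossing limit takes on the L-quad
the value it takes on any corner box of equal modulus (namely `1/2`, the unit square). [folklore] -/
theorem rectilinearHeart_lShapeQuad :
    ∀ Φ : ConformalRectangle → ℝ,
      (∀ R : ConformalRectangle, Tendsto (bondDomainCrossingProb R) (𝓝[>] (0 : ℝ)) (𝓝 (Φ R))) →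
      ∀ R' : ConformalRectangle,
        (∃ w : ℝ, 0 < w ∧ R'.carrier = (Ioo (0 : ℝ) w ×ℂ Ioo (0 : ℝ) 1) ∧
          R'.arc 0 = {z : ℂ | z.re = 0 ∧ z.im ∈ Icc (0 : ℝ) 1} ∧
          R'.arc 2 = {z : ℂ | z.re = w ∧ z.im ∈ Icc (0 : ℝ) 1} ∧
          R'.pt 0 = Complex.I ∧ R'.pt 1 = 0 ∧ R'.pt 2 = (w : ℂ) ∧ R'.pt 3 = (w : ℂ) + Complex.I) →
        ∀ (φ : ConformalEquiv UpperHalfPlane.upperHalfPlaneSet lShapeQuad.carrier) (x : Fin 4 → ℝ)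
          (φ' : ConformalEquiv UpperHalfPlane.upperHalfPlaneSet R'.carrier) (x' : Fin 4 → ℝ),
          lShapeQuad.IsUniformizing φ x → R'.IsUniformizing φ' x' → crossRatio x = crossRatio x' →
          Φ lShapeQuad = Φ R' :=
  stub_heartLShape tendsto_half_lShapeQuad

/-- **The heart H3 on the affinely lattice-antisymmetric family, unconditionally** (`stub_heartOfSymmetric` fed
with `stub_symmetricHalfFull`). [folklore] -/
theorem rectilinearHeart_of_symmetric :
    ∀ Φ : ConformalRectangle → ℝ,
      (∀ R : ConformalRectangle, Tendsto (bondDomainCrossingProb R) (𝓝[>] (0 : ℝ)) (𝓝 (Φ R))) →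
      ∀ (R : ConformalRectangle) (u v : ℂ), (u = 1 ∨ u = -1 ∨ u = Complex.I ∨ u = -Complex.I) →
        u * (starRingEnd ℂ) v + v = 0 →
        (fun z : ℂ => u * (starRingEnd ℂ) z + v) '' R.carrier = R.carrier →
        ((fun z : ℂ => u * (starRingEnd ℂ) z + v) '' R.arc 0 = R.arc 1 ∧
            (fun z : ℂ => u * (starRingEnd ℂ) z + v) '' R.arc 2 = R.arc 3 ∨
          (fun z : ℂ => u * (starRingEnd ℂ) z + v) '' R.arc 0 = R.arc 3 ∧
            (fun z : ℂ => u * (starRingEnd ℂ) z + v) '' R.arc 2 = R.arc 1) →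
        ((u * (starRingEnd ℂ) (R.pt 0) + v = R.pt 0 ∧ u * (starRingEnd ℂ) (R.pt 2) + v = R.pt 2 ∧
            u * (starRingEnd ℂ) (R.pt 1) + v = R.pt 3) ∨
          (u * (starRingEnd ℂ) (R.pt 1) + v = R.pt 1 ∧ u * (starRingEnd ℂ) (R.pt 3) + v = R.pt 3 ∧
            u * (starRingEnd ℂ) (R.pt 0) + v = R.pt 2)) →
        ∀ R' : ConformalRectangle,
          (∃ w : ℝ, 0 < w ∧ R'.carrier = (Ioo (0 : ℝ) w ×ℂ Ioo (0 : ℝ) 1) ∧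
            R'.arc 0 = {z : ℂ | z.re = 0 ∧ z.im ∈ Icc (0 : ℝ) 1} ∧
            R'.arc 2 = {z : ℂ | z.re = w ∧ z.im ∈ Icc (0 : ℝ) 1} ∧
            R'.pt 0 = Complex.I ∧ R'.pt 1 = 0 ∧ R'.pt 2 = (w : ℂ) ∧ R'.pt 3 = (w : ℂ) + Complex.I) →
          ∀ (φ : ConformalEquiv UpperHalfPlane.upperHalfPlaneSet R.carrier) (x : Fin 4 → ℝ)
            (φ' : ConformalEquiv UpperHalfPlane.upperHalfPlaneSet R'.carrier) (x' : Fin 4 → ℝ),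
            R.IsUniformizing φ x → R'.IsUniformizing φ' x' → crossRatio x = crossRatio x' →
            Φ R = Φ R' :=
  stub_heartOfSymmetric stub_symmetricHalfFull

/-- **The crux is equivalent to the heart on POLYOMINO quads with lattice marks** (a countable family):
`←` is `stub_polyominoHeartSuffices` (through `CardyTensorRG.PolyominoToJordan`), `→` is c3's
`modulus_determines_of_similarityUpgrade` (the crux makes Φ modulus-determined on all quads). [folklore] -/
theorem polyominoHeart_iff_similarityUpgrade :
    (∀ Φ : ConformalRectangle → ℝ,
      (∀ R : ConformalRectangle, Tendsto (bondDomainCrossingProb R) (𝓝[>] (0 : ℝ)) (𝓝 (Φ R))) →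
      (∀ (R R' : ConformalRectangle) (a w : ℂ), a ≠ 0 →
        R'.carrier = (fun z : ℂ => a * z + w) '' R.carrier →
        R'.arc 0 = (fun z : ℂ => a * z + w) '' R.arc 0 →
        R'.arc 2 = (fun z : ℂ => a * z + w) '' R.arc 2 → Φ R' = Φ R) →
      ∀ (R R' : ConformalRectangle),
        (∃ δ₀ : ℝ, 0 < δ₀ ∧ (∃ s : Finset (ℤ × ℤ), R.carrier = interior (⋃ p ∈ s,
            {z : ℂ | δ₀ * (p.1 : ℝ) ≤ z.re ∧ z.re ≤ δ₀ * ((p.1 : ℝ) + 1) ∧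
              δ₀ * (p.2 : ℝ) ≤ z.im ∧ z.im ≤ δ₀ * ((p.2 : ℝ) + 1)})) ∧
          ∀ i, ∃ m n : ℤ, R.pt i = (δ₀ : ℂ) * ((m : ℂ) + (n : ℂ) * Complex.I)) →
        (∃ w : ℝ, 0 < w ∧ R'.carrier = (Ioo (0 : ℝ) w ×ℂ Ioo (0 : ℝ) 1) ∧
          R'.arc 0 = {z : ℂ | z.re = 0 ∧ z.im ∈ Icc (0 : ℝ) 1} ∧
          R'.arc 2 = {z : ℂ | z.re = w ∧ z.im ∈ Icc (0 : ℝ) 1} ∧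
          R'.pt 0 = Complex.I ∧ R'.pt 1 = 0 ∧ R'.pt 2 = (w : ℂ) ∧ R'.pt 3 = (w : ℂ) + Complex.I) →
        ∀ (φ : ConformalEquiv UpperHalfPlane.upperHalfPlaneSet R.carrier) (x : Fin 4 → ℝ)
          (φ' : ConformalEquiv UpperHalfPlane.upperHalfPlaneSet R'.carrier) (x' : Fin 4 → ℝ),
          R.IsUniformizing φ x → R'.IsUniformizing φ' x' → crossRatio x = crossRatio x' →
          Φ R = Φ R') ↔
    Summit.CriticalPhenomena.CardyFormulaZ2.Theses.CardyWhiteToColoured.SimilarityUpgrade := by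
  refine ⟨stub_polyominoHeartSuffices, fun hU Φ hlim hsim R R' _ _ φ x φ' x' hx hx' hη => ?_⟩
  exact Theorems.SimilarityUpgradeReduction.modulus_determines_of_similarityUpgrade hU Φ hlim hsim R R' φ x φ' x'
    hx hx' hη

/-- **`stub_c4Bedrock` (registered conjunction)**: the six unconditional results of lead cycle c4 — G1 limit
duality for all `R`; the L-quad crossed with probability `→ 1/2`; Cardy's formula for the L-quad; H3 at the
L-quad; H3 on the affinely lattice-antisymmetric family; crux ⟺ H3 on polyomino quads with lattice marks.
[folklore] -/
theorem stub_c4Bedrock :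
    (∀ Φ : ConformalRectangle → ℝ,
      (∀ R : ConformalRectangle, Tendsto (bondDomainCrossingProb R) (𝓝[>] (0 : ℝ)) (𝓝 (Φ R))) →
      ∀ R R' : ConformalRectangle, R'.carrier = R.carrier →
        (R'.arc 0 = R.arc 1 ∧ R'.arc 2 = R.arc 3 ∨ R'.arc 0 = R.arc 3 ∧ R'.arc 2 = R.arc 1) →
        Φ R + Φ R' = 1) ∧
    Tendsto (bondDomainCrossingProb lShapeQuad)
      (𝓝[>] (0 : ℝ)) (𝓝 (1 / 2)) ∧
    lShapeQuad.HasCrossingLimit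
      (bondDomainCrossingProb lShapeQuad)
      Literature.Probability.RandomPlanarGeometry.cardyFunction ∧
    (∀ Φ : ConformalRectangle → ℝ,
      (∀ R : ConformalRectangle, Tendsto (bondDomainCrossingProb R) (𝓝[>] (0 : ℝ)) (𝓝 (Φ R))) →
      ∀ R' : ConformalRectangle,
        (∃ w : ℝ, 0 < w ∧ R'.carrier = (Ioo (0 : ℝ) w ×ℂ Ioo (0 : ℝ) 1) ∧
          R'.arc 0 = {z : ℂ | z.re = 0 ∧ z.im ∈ Icc (0 : ℝ) 1} ∧
          R'.arc 2 = {z : ℂ | z.re = w ∧ z.im ∈ Icc (0 : ℝ) 1} ∧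
          R'.pt 0 = Complex.I ∧ R'.pt 1 = 0 ∧ R'.pt 2 = (w : ℂ) ∧ R'.pt 3 = (w : ℂ) + Complex.I) →
        ∀ (φ : ConformalEquiv UpperHalfPlane.upperHalfPlaneSet
            lShapeQuad.carrier)
          (x : Fin 4 → ℝ) (φ' : ConformalEquiv UpperHalfPlane.upperHalfPlaneSet R'.carrier) (x' : Fin 4 → ℝ),
          lShapeQuad.IsUniformizing φ x →
          R'.IsUniformizing φ' x' → crossRatio x = crossRatio x' →
          Φ lShapeQuad = Φ R') ∧
    (∀ Φ : ConformalRectangle → ℝ,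
      (∀ R : ConformalRectangle, Tendsto (bondDomainCrossingProb R) (𝓝[>] (0 : ℝ)) (𝓝 (Φ R))) →
      ∀ (R : ConformalRectangle) (u v : ℂ), (u = 1 ∨ u = -1 ∨ u = Complex.I ∨ u = -Complex.I) →
        u * (starRingEnd ℂ) v + v = 0 →
        (fun z : ℂ => u * (starRingEnd ℂ) z + v) '' R.carrier = R.carrier →
        ((fun z : ℂ => u * (starRingEnd ℂ) z + v) '' R.arc 0 = R.arc 1 ∧
            (fun z : ℂ => u * (starRingEnd ℂ) z + v) '' R.arc 2 = R.arc 3 ∨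
          (fun z : ℂ => u * (starRingEnd ℂ) z + v) '' R.arc 0 = R.arc 3 ∧
            (fun z : ℂ => u * (starRingEnd ℂ) z + v) '' R.arc 2 = R.arc 1) →
        ((u * (starRingEnd ℂ) (R.pt 0) + v = R.pt 0 ∧ u * (starRingEnd ℂ) (R.pt 2) + v = R.pt 2 ∧
            u * (starRingEnd ℂ) (R.pt 1) + v = R.pt 3) ∨
          (u * (starRingEnd ℂ) (R.pt 1) + v = R.pt 1 ∧ u * (starRingEnd ℂ) (R.pt 3) + v = R.pt 3 ∧
            u * (starRingEnd ℂ) (R.pt 0) + v = R.pt 2)) →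
        ∀ R' : ConformalRectangle,
          (∃ w : ℝ, 0 < w ∧ R'.carrier = (Ioo (0 : ℝ) w ×ℂ Ioo (0 : ℝ) 1) ∧
            R'.arc 0 = {z : ℂ | z.re = 0 ∧ z.im ∈ Icc (0 : ℝ) 1} ∧
            R'.arc 2 = {z : ℂ | z.re = w ∧ z.im ∈ Icc (0 : ℝ) 1} ∧
            R'.pt 0 = Complex.I ∧ R'.pt 1 = 0 ∧ R'.pt 2 = (w : ℂ) ∧ R'.pt 3 = (w : ℂ) + Complex.I) →
          ∀ (φ : ConformalEquiv UpperHalfPlane.upperHalfPlaneSet R.carrier) (x : Fin 4 → ℝ)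
            (φ' : ConformalEquiv UpperHalfPlane.upperHalfPlaneSet R'.carrier) (x' : Fin 4 → ℝ),
            R.IsUniformizing φ x → R'.IsUniformizing φ' x' → crossRatio x = crossRatio x' →
            Φ R = Φ R') ∧
    ((∀ Φ : ConformalRectangle → ℝ,
      (∀ R : ConformalRectangle, Tendsto (bondDomainCrossingProb R) (𝓝[>] (0 : ℝ)) (𝓝 (Φ R))) →
      (∀ (R R' : ConformalRectangle) (a w : ℂ), a ≠ 0 →
        R'.carrier = (fun z : ℂ => a * z + w) '' R.carrier →
        R'.arc 0 = (fun z : ℂ => a * z + w) '' R.arc 0 →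
        R'.arc 2 = (fun z : ℂ => a * z + w) '' R.arc 2 → Φ R' = Φ R) →
      ∀ (R R' : ConformalRectangle),
        (∃ δ₀ : ℝ, 0 < δ₀ ∧ (∃ s : Finset (ℤ × ℤ), R.carrier = interior (⋃ p ∈ s,
            {z : ℂ | δ₀ * (p.1 : ℝ) ≤ z.re ∧ z.re ≤ δ₀ * ((p.1 : ℝ) + 1) ∧
              δ₀ * (p.2 : ℝ) ≤ z.im ∧ z.im ≤ δ₀ * ((p.2 : ℝ) + 1)})) ∧
          ∀ i, ∃ m n : ℤ, R.pt i = (δ₀ : ℂ) * ((m : ℂ) + (n : ℂ) * Complex.I)) →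
        (∃ w : ℝ, 0 < w ∧ R'.carrier = (Ioo (0 : ℝ) w ×ℂ Ioo (0 : ℝ) 1) ∧
          R'.arc 0 = {z : ℂ | z.re = 0 ∧ z.im ∈ Icc (0 : ℝ) 1} ∧
          R'.arc 2 = {z : ℂ | z.re = w ∧ z.im ∈ Icc (0 : ℝ) 1} ∧
          R'.pt 0 = Complex.I ∧ R'.pt 1 = 0 ∧ R'.pt 2 = (w : ℂ) ∧ R'.pt 3 = (w : ℂ) + Complex.I) →
        ∀ (φ : ConformalEquiv UpperHalfPlane.upperHalfPlaneSet R.carrier) (x : Fin 4 → ℝ)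
          (φ' : ConformalEquiv UpperHalfPlane.upperHalfPlaneSet R'.carrier) (x' : Fin 4 → ℝ),
          R.IsUniformizing φ x → R'.IsUniformizing φ' x' → crossRatio x = crossRatio x' →
          Φ R = Φ R') ↔
      Summit.CriticalPhenomena.CardyFormulaZ2.Theses.CardyWhiteToColoured.SimilarityUpgrade) :=
  ⟨limitDuality, tendsto_half_lShapeQuad, cardy_lShapeQuad, rectilinearHeart_lShapeQuad, rectilinearHeart_of_symmetric,
    polyominoHeart_iff_similarityUpgrade⟩

end Summit.CriticalPhenomena.CardyFormulaZ2.Cruxes.SimilarityUpgrade.Stubs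

end
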